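import Literature.Analysis.Calculus.DerivativeInterpolation
import HarnessLib

/-!
# Landau's interpolation inequality and the decay of all derivatives — local forms

Analysis/Calculus support file (theorems only; no definitions, no named facts). The tree's
`Literature.Analysis.Calculus.norm_iteratedFDeriv_succ_le_of_bounds` and
`Literature.Analysis.Calculus.eventually_norm_iteratedFDeriv_lt` (file
`DerivativeInterpolation.lean`) ask for functions smooth on the whole space. Functions that are
smooth only on an open region (a chart domain, a far cylinder `{r > R}`, an open ball) need the
same two statements with smoothness assumed on the ball only; this file proves them, by the same
two applications of the mean value theorem (`norm_fderiv_le_of_norm_le_of_lipschitz`):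

* `norm_iteratedFDeriv_succ_le_of_bounds_of_contDiffAt` — **Landau 1913 between the orders
  `k, k + 1, k + 2`, local form**: for `f` merely `C^{k+2}` at every point of `ball p r`, if
  `‖Dᵏ f‖ ≤ M₀` and `‖Dᵏ⁺² f‖ ≤ M₂` on the ball then `‖Dᵏ⁺¹ f (p)‖ ≤ 2 M₀ / s + s M₂` for
  `0 < s < r`;
* `eventually_norm_iteratedFDeriv_lt_of_contDiffAt` — **decay of all derivatives from decay of
  the functions plus bounds, local form**: along any filter `l`, functions `g i` which are
  (eventually) smooth at every point of `ball p R`, tend to `0` uniformly there, and have every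
  derivative (eventually) bounded there uniformly in `i`, have all `k`-th derivatives tending to
  `0` uniformly on `ball p (R / 2ᵏ)` (induction on `k` through the first item).

The typical consumer is a weighted decay statement on an unbounded region (e.g. `r · ‖∂₀ h‖ → 0`
as `r → ∞` on a far cylinder, upgraded to `r · ‖Dᵐ ∂₀ h‖ → 0` for every `m` given `r`-weighted
bounds of all orders): index the family by the base point, translate to a fixed ball, and take
`l` = "the weight tends to infinity".
(`Literature.Analysis.FluidPDE.STAssembly.norm_iteratedFDeriv_succ_le_of_bounds_on` is the
first item for `f` smooth on an open `U ⊇ ball p r`, a special case of the version here.)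

## Mathlib search

`Convex.norm_image_sub_le_of_norm_fderiv_le'` (mean value with a fixed linear map),
`ContDiffAt.differentiableAt_iteratedFDeriv`; no interpolation inequality between derivatives
of different orders in Mathlib (`Landau`, `Kolmogorov`, `interpol` in `Analysis/Calculus`).

## References

* E. Landau, *Einige Ungleichungen für zweimal differentiierbare Funktionen*, Proc. LMS 13
  (1913) 43–49.
* J. Dieudonné, *Foundations of Modern Analysis* (1960), (8.6.3)–(8.6.4).
-/

noncomputable section

open Set Filter Function Metric Topology
open scoped ContDiff

namespace Literature.Analysis.Calculus

variable {P : Type*} [NormedAddCommGroup P] [NormedSpace ℝ P]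
variable {G : Type*} [NormedAddCommGroup G] [NormedSpace ℝ G]

/-- **Landau's inequality between consecutive orders, local form.** If `f` is `C^{k+2}` at
every point of `ball p r`, `‖Dᵏ f‖ ≤ M₀` and `‖Dᵏ⁺² f‖ ≤ M₂` on `ball p r` (`M₂ ≥ 0`), then
`‖Dᵏ⁺¹ f (p)‖ ≤ 2 M₀ / s + s M₂` for every `0 < s < r`: the mean value theorem bounds
`‖Dᵏ⁺¹ f (y) - Dᵏ⁺¹ f (p)‖ ≤ M₂ ‖y - p‖` on the ball, and Landau's inequality on a ball
(`norm_fderiv_le_of_norm_le_of_lipschitz`) applies to `F = Dᵏ f`. Landau 1913; Dieudonné 1960,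
(8.6.3). [folklore] -/
theorem norm_iteratedFDeriv_succ_le_of_bounds_of_contDiffAt {f : P → G} {p : P}
    {r M₀ M₂ : ℝ} {k : ℕ} (hf : ∀ y ∈ ball p r, ContDiffAt ℝ (k + 2 : ℕ) f y) (hM₂ : 0 ≤ M₂)
    (h0 : ∀ y ∈ ball p r, ‖iteratedFDeriv ℝ k f y‖ ≤ M₀)
    (h2 : ∀ y ∈ ball p r, ‖iteratedFDeriv ℝ (k + 2) f y‖ ≤ M₂) {s : ℝ} (hs : 0 < s)
    (hsr : s < r) : ‖iteratedFDeriv ℝ (k + 1) f p‖ ≤ 2 * M₀ / s + s * M₂ := by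
  have hdiff : ∀ m < k + 2, ∀ y ∈ ball p r, DifferentiableAt ℝ (iteratedFDeriv ℝ m f) y :=
    fun m hm y hy => (hf y hy).differentiableAt_iteratedFDeriv (by exact_mod_cast hm)
  rw [← norm_fderiv_iteratedFDeriv]
  refine norm_fderiv_le_of_norm_le_of_lipschitz (hdiff k (by omega)) h0 hM₂ (fun y hy => ?_)
    hs hsr
  -- `‖fderiv (Dᵏ f) y - fderiv (Dᵏ f) p‖ = ‖Dᵏ⁺¹ f y - Dᵏ⁺¹ f p‖ ≤ M₂ ‖y - p‖`
  rw [fderiv_iteratedFDeriv_apply_eq_curry, fderiv_iteratedFDeriv_apply_eq_curry,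
    ← LinearIsometryEquiv.map_sub, LinearIsometryEquiv.norm_map]
  have hr0 : 0 < r := hs.trans hsr
  refine (convex_ball p r).norm_image_sub_le_of_norm_fderiv_le (hdiff (k + 1) (by omega))
    (fun z hz => ?_) (mem_ball_self hr0) hy
  rw [norm_fderiv_iteratedFDeriv]
  exact h2 z hz

/-- **All derivatives tend to zero uniformly on smaller balls, local form.** Along a filter
`l`, let `g i` be functions which, eventually along `l`, are `C^∞` at every point of
`ball p R`; suppose they tend to `0` uniformly on `ball p R` and that their derivatives of every
order are, eventually along `l`, bounded on `ball p R` uniformly in `i`. Then for every `k` the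
`k`-th derivatives tend to `0` uniformly on `ball p (R / 2ᵏ)` (induction on `k`: smallness of
order `k` on `ball p (R / 2ᵏ)` and boundedness of order `k + 2` give smallness of order `k + 1`
on `ball p (R / 2ᵏ⁺¹)` by Landau's inequality on balls of radius `R / 2ᵏ⁺¹`,
`norm_iteratedFDeriv_succ_le_of_bounds_of_contDiffAt`). Landau 1913; Dieudonné 1960,
(8.6.3)–(8.6.4). [folklore] -/
theorem eventually_norm_iteratedFDeriv_lt_of_contDiffAt {ι : Type*} {l : Filter ι}
    {g : ι → P → G} {p : P} {R : ℝ} (hR : 0 < R)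
    (hg : ∀ᶠ i in l, ∀ y ∈ ball p R, ContDiffAt ℝ ∞ (g i) y)
    (hb : ∀ k : ℕ, ∃ M : ℝ, ∀ᶠ i in l, ∀ y ∈ ball p R, ‖iteratedFDeriv ℝ k (g i) y‖ ≤ M)
    (h0 : ∀ ε > 0, ∀ᶠ i in l, ∀ y ∈ ball p R, ‖g i y‖ < ε) (k : ℕ) :
    ∀ ε > 0, ∀ᶠ i in l, ∀ y ∈ ball p (R / 2 ^ k), ‖iteratedFDeriv ℝ k (g i) y‖ < ε := by
  have hle : ∀ m : ℕ, (m : ℕ∞ω) ≤ ∞ := fun m => by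
    exact_mod_cast (WithTop.coe_lt_coe.2 (ENat.coe_lt_top m)).le
  induction k with
  | zero =>
    intro ε hε
    simp only [pow_zero, div_one, norm_iteratedFDeriv_zero]
    exact h0 ε hε
  | succ k ih =>
    intro ε hε
    obtain ⟨M, hM⟩ := hb (k + 2)
    set M' : ℝ := max M 0 with hM'
    have hM'0 : 0 ≤ M' := le_max_right _ _
    set r : ℝ := R / 2 ^ (k + 1) with hr
    have hr0 : 0 < r := by positivity
    set s : ℝ := min (r / 2) (ε / (2 * (M' + 1))) with hs_def
    have hs0 : 0 < s := lt_min (by positivity) (by positivity)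
    have hsr : s < r := (min_le_left _ _).trans_lt (by linarith)
    have hsM : s * M' < ε / 2 := by
      calc s * M' ≤ ε / (2 * (M' + 1)) * M' := mul_le_mul_of_nonneg_right (min_le_right _ _) hM'0
        _ < ε / (2 * (M' + 1)) * (M' + 1) := by gcongr; exact lt_add_one _
        _ = ε / 2 := by field_simp
    set η : ℝ := ε * s / 4 with hη
    have hη0 : 0 < η := by positivity
    filter_upwards [ih η hη0, hM, hg] with i hi hMi hgi y hy
    have hsub : ball y r ⊆ ball p (R / 2 ^ k) := ball_subset_ball_half hy
    have hsub' : ball y r ⊆ ball p R := hsub.trans (ball_subset_ball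
      (div_le_self hR.le (one_le_pow₀ (by norm_num))))
    have hL := norm_iteratedFDeriv_succ_le_of_bounds_of_contDiffAt
      (fun z hz => (hgi z (hsub' hz)).of_le (hle (k + 2))) hM'0
      (fun z hz => (hi z (hsub hz)).le) (fun z hz => (hMi z (hsub' hz)).trans (le_max_left _ _))
      hs0 hsr
    calc ‖iteratedFDeriv ℝ (k + 1) (g i) y‖ ≤ 2 * η / s + s * M' := hL
      _ = ε / 2 + s * M' := by rw [hη]; field_simp; ring
      _ < ε / 2 + ε / 2 := by linarith
      _ = ε := by ring

end Literature.Analysis.Calculus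

end
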